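import Summits.CriticalPhenomena.PercolationContinuityZ3.Theorems.SahiBoxTP2HilbertPositivity
import Summits.CriticalPhenomena.PercolationContinuityZ3.Theorems.SahiBoxTP2Transport
import Mathlib.Logic.Denumerable

/-!
# Box-TP₂ laws on countable products `ι → [0,1]`: reindexing the Hilbert cube

Support file of the Sahi cell (`prim-sahi`, typer seat, generation 12; `--supports stmt-CriticalPhenomena-4575`).

The theorems of `SahiBoxTP2HilbertPositivity.lean` are stated on `ℕ → [0,1]` (the coupling is built along `ℕ`).
A bijection `e : ι ≃ ℕ` relabels coordinates by a measurable ORDER ISOMORPHISM `reindex e : (ℕ → X) ≃o (ι → X)`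
(`reindexMeasurableEquiv`), which maps boxes to boxes and preserves box-TP₂ in both directions
(`isBoxTP2_map_reindex_iff`), so every statement transfers to `ι → [0,1]` for any countably infinite index set —
e.g. sites or bonds of `ℤ^d`:

* `msahiE_nonneg_of_isBoxTP2_countable` (+ `_antitone`, `_of_sahiConjecture`, `_of_le_two`),
  `integral_mul_integral_le_of_isBoxTP2_countable` (the FKG inequality, unconditional).

No sorries, no new axioms.
-/

noncomputable section

namespace Summit.CriticalPhenomena.PercolationContinuityZ3.Theorems.SahiBoxTP2

open MeasureTheory ProbabilityTheory Set Filter Topology Function Literature.Combinatorics.Sahi2008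
open scoped ENNReal unitInterval

/-! ### Relabelling coordinates -/

section Reindex

variable {ι X : Type*}

/-- **Relabelling coordinates along `e : ι ≃ ℕ`** as an order isomorphism `(ℕ → X) ≃o (ι → X)`, `u ↦ u ∘ e`. -/
def reindex [Preorder X] (e : ι ≃ ℕ) : (ℕ → X) ≃o (ι → X) where
  toFun u := fun i => u (e i)
  invFun v := fun k => v (e.symm k)
  left_inv u := funext fun k => by simp only [Equiv.apply_symm_apply]
  right_inv v := funext fun i => by simp only [Equiv.symm_apply_apply]
  map_rel_iff' {u v} := by
    constructor
    · intro h k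
      have := h (e.symm k)
      simpa only [Equiv.coe_fn_mk, Equiv.apply_symm_apply] using this
    · intro h i
      exact h (e i)

/-- `reindex e u i = u (e i)`. [folklore] -/
@[simp] theorem reindex_apply [Preorder X] (e : ι ≃ ℕ) (u : ℕ → X) (i : ι) : reindex e u i = u (e i) := rfl

/-- `(reindex e).symm v k = v (e.symm k)`. [folklore] -/
@[simp] theorem reindex_symm_apply [Preorder X] (e : ι ≃ ℕ) (v : ι → X) (k : ℕ) :
    (reindex e).symm v k = v (e.symm k) := rfl

/-- The relabelling as a measurable equivalence. -/
def reindexMeasurableEquiv [MeasurableSpace X] (e : ι ≃ ℕ) : (ℕ → X) ≃ᵐ (ι → X) where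
  toFun u := fun i => u (e i)
  invFun v := fun k => v (e.symm k)
  left_inv u := funext fun k => by simp only [Equiv.apply_symm_apply]
  right_inv v := funext fun i => by simp only [Equiv.symm_apply_apply]
  measurable_toFun := measurable_pi_lambda _ fun i => measurable_pi_apply _
  measurable_invFun := measurable_pi_lambda _ fun k => measurable_pi_apply _

/-- The two relabellings are the same map. [folklore] -/
theorem coe_reindexMeasurableEquiv [Preorder X] [MeasurableSpace X] (e : ι ≃ ℕ) :
    (reindexMeasurableEquiv (X := X) e : (ℕ → X) → (ι → X)) = reindex e := rfl

/-- … and so are their inverses. [folklore] -/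
theorem coe_reindexMeasurableEquiv_symm [Preorder X] [MeasurableSpace X] (e : ι ≃ ℕ) :
    ((reindexMeasurableEquiv (X := X) e).symm : (ι → X) → (ℕ → X)) = (reindex e).symm := rfl

/-- The relabelling is a measurable embedding. [folklore] -/
theorem measurableEmbedding_reindex [Preorder X] [MeasurableSpace X] (e : ι ≃ ℕ) :
    MeasurableEmbedding (reindex (X := X) e) := by
  rw [← coe_reindexMeasurableEquiv]; exact (reindexMeasurableEquiv e).measurableEmbedding

/-- The inverse relabelling is a measurable embedding. [folklore] -/
theorem measurableEmbedding_reindex_symm [Preorder X] [MeasurableSpace X] (e : ι ≃ ℕ) :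
    MeasurableEmbedding (reindex (X := X) e).symm := by
  rw [← coe_reindexMeasurableEquiv_symm]; exact (reindexMeasurableEquiv e).symm.measurableEmbedding

/-- **Box-TP₂ is invariant under relabelling coordinates.** [folklore] -/
theorem isBoxTP2_map_reindex_symm_iff [Lattice X] [MeasurableSpace X] (e : ι ≃ ℕ) (μ : Measure (ι → X)) :
    IsBoxTP2 (μ.map (reindex e).symm) ↔ IsBoxTP2 μ := by
  constructor
  · intro h
    have h2 := h.map_orderIso (reindex e) (measurableEmbedding_reindex e)
    rwa [Measure.map_map (measurableEmbedding_reindex e).measurable (measurableEmbedding_reindex_symm e).measurable,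
      show (reindex (X := X) e : (ℕ → X) → (ι → X)) ∘ (reindex e).symm = id from
        funext fun v => (reindex e).apply_symm_apply v, Measure.map_id] at h2
  · intro h
    exact h.map_orderIso (reindex e).symm (measurableEmbedding_reindex_symm e)

end Reindex

/-! ### Box-TP₂ laws on `ι → [0,1]`, `ι` countably infinite -/

section Relabel

variable {ι X : Type*} [Preorder X] [MeasurableSpace X]

/-- A probability measure relabelled to `ℕ → X` is a probability measure. [folklore] -/
instance instIsProbabilityMeasureMapReindexSymm (e : ι ≃ ℕ) (μ : Measure (ι → X)) [IsProbabilityMeasure μ] :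
    IsProbabilityMeasure (μ.map (reindex e).symm) :=
  Measure.isProbabilityMeasure_map (measurableEmbedding_reindex_symm e).measurable.aemeasurable

/-- A finite measure relabelled to `ℕ → X` is finite. [folklore] -/
instance instIsFiniteMeasureMapReindexSymm (e : ι ≃ ℕ) (μ : Measure (ι → X)) [IsFiniteMeasure μ] :
    IsFiniteMeasure (μ.map (reindex e).symm) :=
  Measure.isFiniteMeasure_map μ _

/-- `reindex e` is measure preserving from the relabelled law back to `μ`. [folklore] -/
theorem measurePreserving_reindex (e : ι ≃ ℕ) (μ : Measure (ι → X)) :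
    MeasurePreserving (reindex e) (μ.map (reindex e).symm) μ := by
  refine ⟨(measurableEmbedding_reindex e).measurable, ?_⟩
  rw [Measure.map_map (measurableEmbedding_reindex e).measurable (measurableEmbedding_reindex_symm e).measurable,
    show (reindex (X := X) e : (ℕ → X) → (ι → X)) ∘ (reindex e).symm = id from
      funext fun v => (reindex e).apply_symm_apply v, Measure.map_id]

end Relabel

section Countable

variable {ι : Type*} {n : ℕ}

/-- **`(∀ d, LiebSahiContinuum d n)` ⟹ every box-TP₂ probability measure on `ι → [0,1]` (`ι ≃ ℕ`) is Sahi-positive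
of order `n`** for all measurable nonnegative monotone families. [this work] -/
theorem msahiE_nonneg_of_isBoxTP2_countable (e : ι ≃ ℕ) (hL : ∀ d, LiebSahiContinuum d n) (μ : Measure (ι → I))
    [IsProbabilityMeasure μ] (hμ : IsBoxTP2 μ) (f : Fin n → (ι → I) → ℝ) (hfm : ∀ i, Measurable (f i))
    (hf0 : ∀ i u, 0 ≤ f i u) (hmono : ∀ i, Monotone (f i)) : 0 ≤ msahiE μ n f := by
  rw [← msahiE_comp_measurePreserving (measurePreserving_reindex e μ) (measurableEmbedding_reindex e) n f]
  exact msahiE_nonneg_of_isBoxTP2_hilbert hL _ ((isBoxTP2_map_reindex_symm_iff e μ).2 hμ) _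
    (fun i => (hfm i).comp (measurableEmbedding_reindex e).measurable) (fun i u => hf0 i _)
    fun i u v huv => hmono i ((reindex e).monotone huv)

/-- Decreasing families on `ι → [0,1]`. [this work] -/
theorem msahiE_nonneg_of_isBoxTP2_countable_antitone (e : ι ≃ ℕ) (hL : ∀ d, LiebSahiContinuum d n)
    (μ : Measure (ι → I)) [IsProbabilityMeasure μ] (hμ : IsBoxTP2 μ) (f : Fin n → (ι → I) → ℝ)
    (hfm : ∀ i, Measurable (f i)) (hf0 : ∀ i u, 0 ≤ f i u) (hanti : ∀ i, Antitone (f i)) : 0 ≤ msahiE μ n f := by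
  rw [← msahiE_comp_measurePreserving (measurePreserving_reindex e μ) (measurableEmbedding_reindex e) n f]
  exact msahiE_nonneg_of_isBoxTP2_hilbert_antitone hL _ ((isBoxTP2_map_reindex_symm_iff e μ).2 hμ) _
    (fun i => (hfm i).comp (measurableEmbedding_reindex e).measurable) (fun i u => hf0 i _)
    fun i u v huv => hanti i ((reindex e).monotone huv)

/-- From `C_n`, on `ι → [0,1]`. [this work; cite: Sahi2008, Conj. 5 (p. 212); LiebSahi2021, Conj. 1.1] -/
theorem msahiE_nonneg_of_isBoxTP2_countable_of_sahiConjecture (e : ι ≃ ℕ) (hC : SahiConjecture n)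
    (μ : Measure (ι → I)) [IsProbabilityMeasure μ] (hμ : IsBoxTP2 μ) (f : Fin n → (ι → I) → ℝ)
    (hfm : ∀ i, Measurable (f i)) (hf0 : ∀ i u, 0 ≤ f i u) (hmono : ∀ i, Monotone (f i)) : 0 ≤ msahiE μ n f :=
  msahiE_nonneg_of_isBoxTP2_countable e ((sahiConjecture_iff_forall_liebSahiContinuum n).1 hC) μ hμ f hfm hf0 hmono

/-- **Unconditionally, `n ≤ 2`** on `ι → [0,1]`. [this work] -/
theorem msahiE_nonneg_of_isBoxTP2_countable_of_le_two (e : ι ≃ ℕ) (hn : n ≤ 2) (μ : Measure (ι → I))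
    [IsProbabilityMeasure μ] (hμ : IsBoxTP2 μ) (f : Fin n → (ι → I) → ℝ) (hfm : ∀ i, Measurable (f i))
    (hf0 : ∀ i u, 0 ≤ f i u) (hmono : ∀ i, Monotone (f i)) : 0 ≤ msahiE μ n f :=
  msahiE_nonneg_of_isBoxTP2_countable e (fun d => liebSahiContinuum_of_order_le_two d hn) μ hμ f hfm hf0 hmono

/-- **The FKG inequality for box-TP₂ laws on `ι → [0,1]`**, `ι` countably infinite: `∫ f ∫ g ≤ ∫ f g` for
measurable nonnegative monotone `f, g`. [this work] -/
theorem integral_mul_integral_le_of_isBoxTP2_countable (e : ι ≃ ℕ) (μ : Measure (ι → I)) [IsProbabilityMeasure μ]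
    (hμ : IsBoxTP2 μ) {f g : (ι → I) → ℝ} (hfm : Measurable f) (hgm : Measurable g) (hf0 : ∀ u, 0 ≤ f u)
    (hg0 : ∀ u, 0 ≤ g u) (hf : Monotone f) (hg : Monotone g) :
    (∫ u, f u ∂μ) * (∫ u, g u ∂μ) ≤ ∫ u, f u * g u ∂μ := by
  have h := msahiE_nonneg_of_isBoxTP2_countable_of_le_two e le_rfl μ hμ ![f, g]
    (fun i => by fin_cases i <;> assumption) (fun i => by fin_cases i <;> assumption)
    (fun i => by fin_cases i <;> assumption)
  rw [msahiE_two] at h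
  linarith

/-- The same statements with `[Countable ι] [Infinite ι]` in place of an explicit bijection. [this work] -/
theorem msahiE_nonneg_of_isBoxTP2_countable' [Countable ι] [Infinite ι] (hL : ∀ d, LiebSahiContinuum d n)
    (μ : Measure (ι → I)) [IsProbabilityMeasure μ] (hμ : IsBoxTP2 μ) (f : Fin n → (ι → I) → ℝ)
    (hfm : ∀ i, Measurable (f i)) (hf0 : ∀ i u, 0 ≤ f i u) (hmono : ∀ i, Monotone (f i)) : 0 ≤ msahiE μ n f := by
  obtain ⟨D⟩ := nonempty_denumerable ι
  exact msahiE_nonneg_of_isBoxTP2_countable (Denumerable.eqv ι) hL μ hμ f hfm hf0 hmono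

end Countable

end Summit.CriticalPhenomena.PercolationContinuityZ3.Theorems.SahiBoxTP2
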